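import Mathlib
import Literature.MathematicalPhysics.MHD.BallooningSAlphaStableSide
import Literature.Analysis.ValidatedNumerics.TaylorModelZeroCert
import HarnessLib
import Summits.Ventures.FusionMHD.Models.SAlphaStableS1A06Defs

/-!
# Kernel exclusion certificates, parts A, B, for `SAlphaStableS1A06.lean` (companion file; split for build time only)

The residual straight-line program `resProg` of the `s–α` stable-side instance `(s, α) = (1, 3/5)`, its Taylor-model
parameters `prm`, and the KERNEL CHECKS (`decide` + kernel) that every exclusion leaf of parts
A `[0, 4]`, B `[4, 8]` excludes a zero of the program.  Pure `Bool`
computations over `Literature/Analysis/ValidatedNumerics/TaylorModelZeroCert.lean`; their real-analysis reading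
(`res_ne_zero*`, via `OpTangent.trig.forall_ne_zero_of_zerosCheck` and `resProg_toFunP`) is in `SAlphaStableS1A06.lean`.
Tilings = PROPOSALS of the untrusted `#eval OpModel.trig.exclAdapt`, re-checked here by the kernel.
2 `decide +kernel`, no `native_decide`, 0 kit, 0 named facts. [instance data]
[cite: Freidberg2014, §12.6.2 eqs. (12.96)–(12.100)]
-/

noncomputable section

open Real Set
open Literature.Analysis.ValidatedNumerics.PolyMP
open Literature.Analysis.ValidatedNumerics.ExpPoly
open Literature.MathematicalPhysics.MHD.Ballooning

namespace Summit.Ventures.FusionMHD.Models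

namespace SAlphaStableS1A06

/-- THE RESIDUAL PROGRAM (25 statements): `Λ = sθ − α sin θ`, `f = 1 + Λ²`, `ŝ = s − α cos θ`;
computes `f²·F″ + (α cos θ · f − ŝ²)·F`. [instance data] -/
def resProg : TProg := [
  TOp.base (SOp.poly [0, (1 : ℚ)]),
  TOp.base (SOp.poly [0, 1]),
  TOp.sin 0,
  TOp.cos 1,
  TOp.base (SOp.poly [(-3 : ℚ) / 5]),
  TOp.base (SOp.mul 0 2),
  TOp.base (SOp.add 5 0),
  TOp.base (SOp.mul 0 0),
  TOp.base (SOp.poly [1]),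
  TOp.base (SOp.add 0 1),
  TOp.base (SOp.mul 0 0),
  TOp.base (SOp.mul 6 7),
  TOp.base (SOp.poly [(1 : ℚ)]),
  TOp.base (SOp.add 0 1),
  TOp.base (SOp.mul 0 0),
  TOp.base (SOp.poly [(3 : ℚ) / 5]),
  TOp.base (SOp.mul 0 12),
  TOp.base (SOp.mul 0 7),
  TOp.base (SOp.neg 3),
  TOp.base (SOp.add 1 0),
  TOp.base (SOp.poly coreCoeffs),
  TOp.base (SOp.poly coreCoeffs2),
  TOp.base (SOp.mul 11 0),
  TOp.base (SOp.mul 3 2),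
  TOp.base (SOp.add 1 0) ]

/-- Taylor-model parameters (degree 12; 14 series terms; `e^{ic}` point values: 20 terms after 5 halvings — `PolyMP.cisPt`
needs `|leaf centre| ≤ 2^kt`, so `kt = 5` serves centres up to `32`); fixed-point scale `2^60`. [instance data] -/
def prm : TrigPrm := ⟨12, 14, 1, 1, 40, 20, 5⟩

/-- The 9 EXCLUSION LEAVES of certificate part A, tiling `[0, 4]` (half-widths 1 / 8, 1 / 4; proposed by the untrusted `#eval OpModel.trig.exclAdapt`). [instance data] -/
def leavesA : List ZLeaf :=
  [⟨1 / 8, 1 / 8, [], [], [], none⟩, ⟨3 / 8, 1 / 8, [], [], [], none⟩, ⟨3 / 4, 1 / 4, [], [], [], none⟩, ⟨5 / 4, 1 / 4, [], [], [], none⟩, ⟨7 / 4, 1 / 4, [], [], [], none⟩, ⟨9 / 4, 1 / 4, [], [], [], none⟩, ⟨11 / 4, 1 / 4, [], [], [], none⟩, ⟨13 / 4, 1 / 4, [], [], [], none⟩, ⟨15 / 4, 1 / 4, [], [], [], none⟩]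

/-- The 3 EXCLUSION LEAVES of certificate part B, tiling `[4, 8]` (half-widths 1 / 2, 1; proposed by the untrusted `#eval OpModel.trig.exclAdapt`). [instance data] -/
def leavesB : List ZLeaf :=
  [⟨9 / 2, 1 / 2, [], [], [], none⟩, ⟨11 / 2, 1 / 2, [], [], [], none⟩, ⟨7, 1, [], [], [], none⟩]

/-- **KERNEL CHECK, part A**: every leaf's Taylor model of `resProg` on `[0, 4]` excludes `0` (no Newton leaf).
[instance data] -/
theorem zeros_certA :
    OpTangent.trig.toOpTangentCore.zerosCheck prm (2 ^ 60) resProg [] (0) (4) leavesA = true := by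
  decide +kernel

/-- **KERNEL CHECK, part B**: every leaf's Taylor model of `resProg` on `[4, 8]` excludes `0` (no Newton leaf).
[instance data] -/
theorem zeros_certB :
    OpTangent.trig.toOpTangentCore.zerosCheck prm (2 ^ 60) resProg [] (4) (8) leavesB = true := by
  decide +kernel

end SAlphaStableS1A06

end Summit.Ventures.FusionMHD.Models

end
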